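import Literature.NumberTheory.EllipticCurves.ModularFormsLevelRank
import Literature.NumberTheory.EllipticCurves.ModularFormsLevelFreeModuleGeneral
import Mathlib.LinearAlgebra.Trace
import Mathlib.RingTheory.RootsOfUnity.Complex
import HarnessLib

/-!
# The rank input with column weights, `rank M(Γ) = [SL₂(ℤ) : Γ]` for every finite-index
# `Γ ∋ T`, and the weights modulo `4` and `6` for free `S`- and `ST`-actions
# (the level theory of `ModularFormsLevelRank` without `-1 ∈ Γ`)

`ModularFormsLevelRank` turns a `Level.RankInput Γ` — `[SL₂(ℤ) : Γ]` forms of a *common* weight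
with invertible conjugate matrix — into the rank `[SL₂(ℤ) : Γ]` of `M(Γ)` over `ℂ[E₄, E₆]`, the
nonvanishing of the basis determinant `𝒟`, and the constraints on the generator weights modulo `4`
and `6`, all under `-1 ∈ Γ`. For a level `Γ ∌ -1` (e.g. `Γ₁(N)`, `N ≥ 3`) a common weight is
impossible (the rows of the cosets `g` and `-g` are proportional), and `S`, `ST` act on
`SL₂(ℤ)/Γ` with orders `4`, `6`. This file supplies the `-1`-free replacements:

* `Level.RankInput' Γ`: `[SL₂(ℤ) : Γ]` forms `G_i ∈ M_{w_i}(Γ)` of weights `w_i ≥ 0` (a weight per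
  column) whose conjugate matrix over `SL₂(ℤ)/Γ` is invertible at some point; `RankInput'.indep`
  (`ℂ[E₄,E₆]`-independence); `IsLevelBasis.index_le'` (`[SL₂(ℤ):Γ] ≤ r` for any level-one basis —
  counted *per parity*: the `G_i` of parity `ε` give `dim M_m(Γ) ≥ #{i : w_i ≡ ε}·L` in weights
  `m = 12L + W' ≡ ε`, the basis gives `dim M_m(Γ) ≤ #{j : k_j ≡ ε}(L + c)`);
  **`Level.exists_isLevelBasis_card_eq'`** (with `exists_isLevelBasis'`: a level-one basis indexed
  by `Fin [SL₂(ℤ) : Γ]`, weights `≥ 0`); `exists_basisDet_ne_zero'` (`𝒟 ≢ 0`);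
  `RankInput.toRankInput'` embeds the old notion.
* the determinant consequences from the mere hypothesis `h𝒟 : ∃ τ, 𝒟(τ) ≠ 0`:
  `basisDet_ne_zero_of_exists` (`𝒟` has no zero on `ℍ`, via `𝒟¹² = cΔ^K`),
  `tendsto_norm_basisDet_pow_of_exists`, `linearIndependent_basisMatrix_col_of_exists`.
* **the trace method for the elliptic constraints** (`sum_eigen_eq_card_fixed`,
  `mul_card_filter_dvd_eq_of_sum_zpow_pow_eq_zero`, `mul_card_weights_dvd_sub_eq`): if `h ∈ SL₂(ℤ)`
  fixes `z₀` with `j(h, z₀) = ζ` a primitive `q`-th root of unity and `h, h², …, h^{q-1}` fix no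
  coset of `SL₂(ℤ)/Γ`, then the covariance `Φ(z₀)_{h⁻¹a, j} = ζ^{-k_j} Φ(z₀)_{a,j}` of the
  invertible basis matrix gives `∑_j ζ^{-d k_j} = tr(P_h^d) = #Fix(h^d) = 0` for `0 < d < q`, whence
  by Fourier inversion **`q · #{j : k_j ≡ r (q)} = [SL₂(ℤ) : Γ]` for every `r`**. For `Γ ∌ -1`,
  `S` always acts freely (`S² = -1`; `S_pow_smul_ne_of_neg_one_not_mem`), so the weights are
  equidistributed modulo `4` (`four_mul_card_weights_eq`, `ζ = i` at `z₀ = i`); `ST` acts freely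
  iff no conjugate of `(ST)²` or `(ST)⁴ = -(ST)` lies in `Γ` (e.g. `Γ₁(N)`, `N ≥ 4`), and then they are
  equidistributed modulo `6` (`six_mul_card_weights_eq`, `ζ = ρ + 1` at `z₀ = ρ`).

Everything is proved; no named facts.

## References

* T. Gannon, *The theory of vector-valued modular forms for the modular group*, Contrib. Math.
  Comput. Sci. 8 (2014), 247–286, Thm. 3.4, §3.5.
* C. Marks, G. Mason, *Structure of the module of vector-valued modular forms*, J. London Math.
  Soc. (2) 82 (2010), 32–48.
-/

noncomputable section

open UpperHalfPlane hiding I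
open ModularForm Complex Matrix.SpecialLinearGroup Filter Asymptotics CongruenceSubgroup
open scoped MatrixGroups Real ModularForm Topology Manifold

namespace Literature.NumberTheory.EllipticCurves.ModularForms

namespace Level

/-! ### Rank inputs with column weights -/

section Rank

variable (Γ : Subgroup SL(2, ℤ)) [Γ.FiniteIndex]

/-- **A rank input with column weights** for the level `Γ`: `[SL₂(ℤ) : Γ]` forms
`G_i ∈ M_{w_i}(Γ)`, `w_i ≥ 0`, whose conjugate matrix `((G_i ∣ g_a⁻¹)(τ))_{a,i}` over the cosets
`g_aΓ` is invertible at some point `τ` (for `Γ ∌ -1` the weights must take both parities).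
[cite: Gannon2014, Thm. 3.4(a)] -/
structure RankInput' where
  /-- The weights of the forms. -/
  wtG : Fin Γ.index → ℤ
  /-- The forms. -/
  G : Fin Γ.index → ℍ → ℂ
  /-- The weights are non-negative. -/
  wtG_nonneg : ∀ i, 0 ≤ wtG i
  /-- The forms are modular of level `Γ`. -/
  mem : ∀ i, G i ∈ levelSpace Γ (wtG i)
  /-- The conjugate matrix is invertible somewhere. -/
  det_ne_zero : ∃ τ : ℍ,
    (Matrix.of fun a i : Fin Γ.index ↦ cosetSlash Γ (wtG i) (G i) ((cosetEquiv Γ).symm a) τ).det ≠ 0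

variable {Γ}

/-- A rank input of common weight is a rank input with column weights. [folklore] -/
def RankInput.toRankInput' (R : RankInput Γ) : RankInput' Γ where
  wtG _ := R.wt₀
  G := R.G
  wtG_nonneg _ := R.wt₀_nonneg
  mem := R.mem
  det_ne_zero := R.det_ne_zero

/-- The conjugate matrix of a rank input, as a function of `τ`. [folklore] -/
def RankInput'.conjMatrix (R : RankInput' Γ) (τ : ℍ) : Matrix (Fin Γ.index) (Fin Γ.index) ℂ :=
  Matrix.of fun a i ↦ cosetSlash Γ (R.wtG i) (R.G i) ((cosetEquiv Γ).symm a) τ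

/-- The conjugate determinant is holomorphic. [folklore] -/
theorem RankInput'.mdifferentiable_det (R : RankInput' Γ) : MDiff (fun τ ↦ (R.conjMatrix τ).det) := by
  have : (fun τ ↦ (R.conjMatrix τ).det) = ∑ σ : Equiv.Perm (Fin Γ.index),
      (fun _ ↦ ((Equiv.Perm.sign σ : ℤ) : ℂ)) * ∏ i, (fun τ ↦ R.conjMatrix τ (σ i) i) := by
    funext τ
    rw [Matrix.det_apply']
    simp only [Finset.sum_apply, Pi.mul_apply, Finset.prod_apply]
  rw [this]
  exact mdifferentiable_finset_sum _ fun σ _ ↦ mdifferentiable_const.mul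
    (mdifferentiable_finset_prod _ fun i _ ↦ mdifferentiable_cosetSlash (R.mem i) _)

/-- **A rank input is `ℂ[E₄, E₆]`-independent**: a homogeneous relation `∑ p_i G_i = 0` of weight
`w` with level-one `p_i ∈ R_{w - w_i}` is trivial (slash by `g_a⁻¹`: `conjMatrix(τ) · p(τ) = 0`;
the holomorphic determinant is `≢ 0`). [folklore] -/
theorem RankInput'.indep (R : RankInput' Γ) (w : ℤ) (p : Fin Γ.index → ℍ → ℂ)
    (hp : ∀ i, p i ∈ levelOneSpace (w - R.wtG i)) (h0 : ∑ i, p i * R.G i = 0) : ∀ i, p i = 0 := by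
  classical
  have hrel : ∀ (a : Fin Γ.index) (τ : ℍ), ∑ i, R.conjMatrix τ a i * p i τ = 0 := by
    intro a τ
    set g : SL(2, ℤ) := ((cosetEquiv Γ).symm a).out with hg
    have h1 := congrArg (fun f : ℍ → ℂ ↦ (f ∣[w] ((g⁻¹ : SL(2, ℤ)) : GL (Fin 2) ℝ)) τ) h0
    simp only [SlashAction.zero_slash, Pi.zero_apply] at h1
    rw [← h1, sum_mul_slash_of_levelOne _ (fun i _ ↦ hp i), Finset.sum_apply]
    refine Finset.sum_congr rfl fun i _ ↦ ?_
    rw [Pi.mul_apply, mul_comm]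
    rfl
  have hpt : ∀ τ, (R.conjMatrix τ).det ≠ 0 → ∀ i, p i τ = 0 := by
    intro τ hτ i
    have hv : (R.conjMatrix τ).mulVec (fun i ↦ p i τ) = 0 := by
      funext a
      exact hrel a τ
    exact congrFun (Matrix.eq_zero_of_mulVec_eq_zero hτ hv) i
  have hdet0 : (fun τ ↦ (R.conjMatrix τ).det) ≠ 0 := by
    obtain ⟨τ, hτ⟩ := R.det_ne_zero
    intro h
    exact hτ (congrFun h τ)
  intro i
  have hprod : (fun τ ↦ (R.conjMatrix τ).det) * p i = 0 := by
    funext τ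
    by_cases hτ : (R.conjMatrix τ).det = 0
    · simp [hτ]
    · simp [hpt τ hτ i]
  exact eq_zero_of_mul_eq_zero_of_mdifferentiable R.mdifferentiable_det hdet0
    (mdifferentiable_of_mem_formSpace (hp i)).continuous hprod

/-- `a L ≤ b (L + c)` for all `L` forces `a ≤ b`. [folklore] -/
theorem le_of_forall_mul_le {a b c : ℕ} (h : ∀ L : ℕ, a * L ≤ b * (L + c)) : a ≤ b := by
  by_contra hlt
  push Not at hlt
  have h1 := h (b * c + 1)
  have h3 : (b + 1) * (b * c + 1) ≤ b * (b * c + 1 + c) :=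
    (Nat.mul_le_mul_right _ hlt).trans h1
  nlinarith

/-- `R_w = 0` for odd `w` (level one, `-1 ∈ SL₂(ℤ)`). [folklore] -/
theorem levelOneSpace_eq_bot_of_odd {w : ℤ} (hw : Odd w) : levelOneSpace w = ⊥ :=
  formSpace_eq_bot_of_odd (⟨-1, by ext; simp⟩ : (-1 : GL (Fin 2) ℝ) ∈ 𝒮ℒ) hw

variable [hT : Fact (ModularGroup.T ∈ Γ)]

omit hT in
/-- A weight occurring in a level-one basis is `≥ 0`. [folklore] -/
theorem IsLevelBasis.wt_nonneg {r : ℕ} {wt : Fin r → ℤ} {F : Fin r → ℍ → ℂ}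
    (hb : IsLevelBasis Γ wt F) (i : Fin r) : 0 ≤ wt i := by
  have h0 := hb.mem i
  by_contra hneg
  push Not at hneg
  have : levelSpace Γ (wt i) = ⊥ := formSpace_eq_bot_of_neg hneg
  rw [this, Submodule.mem_bot] at h0
  have := hb.indep (wt i) (fun j ↦ if j = i then 1 else 0) (fun j ↦ by
    split_ifs with hj
    · subst hj; rw [sub_self]; exact ⟨1, ModularForm.one_coe_eq_one⟩
    · exact Submodule.zero_mem _) (by simp [h0]) i
  simp at this

variable (Γ) in
/-- **Rank `≥ [SL₂(ℤ) : Γ]`, per parity**: for a level-one basis on `r` generators and a rank input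
with column weights, `#{i : w_i ≡ ε (2)} ≤ #{j : k_j ≡ ε (2)}` for `ε = 0, 1`. [cite: Gannon2014, Thm. 3.4] -/
theorem IsLevelBasis.card_parity_le {r : ℕ} {wt : Fin r → ℤ} {F : Fin r → ℍ → ℂ}
    (hb : IsLevelBasis Γ wt F) (R : RankInput' Γ) (ε : ℤ) (hε : ε = 0 ∨ ε = 1) :
    (Finset.univ.filter fun i ↦ R.wtG i % 2 = ε).card ≤
      (Finset.univ.filter fun j ↦ wt j % 2 = ε).card := by
  classical
  set I := Finset.univ.filter fun i ↦ R.wtG i % 2 = ε with hI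
  set J := Finset.univ.filter fun j ↦ wt j % 2 = ε with hJ
  -- a common bound `W` for the column weights, of parity `ε`
  obtain ⟨W, hW0, hWε, hW⟩ : ∃ W : ℤ, 0 ≤ W ∧ W % 2 = ε ∧ ∀ i, R.wtG i ≤ W := by
    refine ⟨2 * ∑ i, R.wtG i + ε, ?_, by omega, fun i ↦ ?_⟩
    · have := Finset.sum_nonneg fun i (_ : i ∈ Finset.univ) ↦ R.wtG_nonneg i
      omega
    · have := Finset.single_le_sum (fun j _ ↦ R.wtG_nonneg j) (Finset.mem_univ i)
      have h2 := Finset.sum_nonneg fun i (_ : i ∈ Finset.univ) ↦ R.wtG_nonneg i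
      omega
  set c : ℕ := W.toNat / 12 + 1 with hc
  refine le_of_forall_mul_le (c := c) fun L ↦ ?_
  set m : ℤ := 12 * L + W with hm
  -- lower bound from the rank input restricted to `I`
  let Φ : (Π i : I, levelOneSpace (m - R.wtG i)) →ₗ[ℂ] (ℍ → ℂ) :=
    { toFun := fun p ↦ ∑ i : I, ((p i : ℍ → ℂ) * R.G i : ℍ → ℂ)
      map_add' := fun p p' ↦ by
        simp only [Pi.add_apply, Submodule.coe_add, add_mul, Finset.sum_add_distrib]
      map_smul' := fun c p ↦ by
        simp only [Pi.smul_apply, Submodule.coe_smul, RingHom.id_apply, Finset.smul_sum, smul_mul_assoc] }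
  have hΦmem : ∀ p, Φ p ∈ levelSpace Γ m := fun p ↦ by
    show (∑ i : I, ((p i : ℍ → ℂ) * R.G i : ℍ → ℂ)) ∈ levelSpace Γ m
    refine Submodule.sum_mem _ fun i _ ↦ ?_
    have := levelOne_mul_mem Γ (p i).2 (R.mem i)
    rwa [sub_add_cancel] at this
  have hΦinj : Function.Injective (Φ.codRestrict _ hΦmem) := by
    rw [injective_iff_map_eq_zero]
    intro p hp0
    have hsum0 : ∑ i : I, ((p i : ℍ → ℂ) * R.G i : ℍ → ℂ) = 0 := congrArg Subtype.val hp0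
    let P : Fin Γ.index → ℍ → ℂ := fun i ↦ if h : i ∈ I then (p ⟨i, h⟩ : ℍ → ℂ) else 0
    have hP : ∀ i, P i ∈ levelOneSpace (m - R.wtG i) := fun i ↦ by
      by_cases h : i ∈ I
      · simp only [P, h, dif_pos]; exact (p ⟨i, h⟩).2
      · simp only [P, h, dif_neg, not_false_eq_true]; exact Submodule.zero_mem _
    have hPsum : ∑ i, P i * R.G i = 0 := by
      rw [← Finset.sum_subset (Finset.subset_univ I) (fun i _ hi ↦ by simp [P, hi])]
      rw [← hsum0, ← Finset.sum_coe_sort I]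
      refine Finset.sum_congr rfl fun i _ ↦ ?_
      simp [P, i.2]
    have hP0 := R.indep m P hP hPsum
    funext i
    apply Subtype.ext
    have := hP0 i
    simp only [P, i.2, dif_pos] at this
    simpa using this
  have hlow : I.card * L ≤ Module.finrank ℂ (levelSpace Γ m) := by
    refine le_trans ?_ (LinearMap.finrank_le_finrank_of_injective hΦinj)
    rw [Module.finrank_pi_fintype]
    have : I.card * L = ∑ _i : I, L := by simp
    rw [this]
    refine Finset.sum_le_sum fun i _ ↦ ?_
    have hi : R.wtG i % 2 = ε := (Finset.mem_filter.mp i.2).2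
    have hwi := hW i
    obtain ⟨n, hn⟩ : ∃ n : ℕ, m - R.wtG i = 2 * n := ⟨((m - R.wtG i) / 2).toNat, by omega⟩
    rw [hn, show (2 * (n : ℤ)) = ((2 * n : ℕ) : ℤ) by push_cast; ring]
    refine le_trans ?_ (le_finrank_levelOneSpace ⟨n, by ring⟩)
    omega
  -- upper bound from the basis: only generators of parity `ε` contribute
  have hup : Module.finrank ℂ (levelSpace Γ m) ≤ J.card * (L + c) := by
    rw [hb.finrank_eq m, ← Finset.sum_filter_add_sum_filter_not Finset.univ (fun j ↦ wt j % 2 = ε)]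
    have hzero : ∑ j ∈ Finset.univ.filter (fun j ↦ ¬ wt j % 2 = ε),
        Module.finrank ℂ (levelOneSpace (m - wt j)) = 0 := by
      refine Finset.sum_eq_zero fun j hj ↦ ?_
      have hj := (Finset.mem_filter.mp hj).2
      have hodd : Odd (m - wt j) := by
        have h2 := Int.emod_two_eq_zero_or_one (wt j)
        rcases hε with rfl | rfl <;> exact ⟨(m - wt j) / 2, by omega⟩
      rw [levelOneSpace_eq_bot_of_odd hodd, finrank_bot]
    rw [hzero, add_zero]
    have : J.card * (L + c) = ∑ _j ∈ J, (L + c) := by simp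
    rw [this]
    refine Finset.sum_le_sum fun j _ ↦ ?_
    refine (finrank_levelOneSpace_le (m - wt j)).trans ?_
    have hwt0 : 0 ≤ wt j := hb.wt_nonneg j
    have h1 : (m - wt j).toNat ≤ 12 * L + W.toNat := by rw [hm]; omega
    have h2 : (12 * L + W.toNat) / 12 + 1 ≤ L + c := by rw [hc]; omega
    exact le_trans (Nat.add_le_add_right (Nat.div_le_div_right h1) 1) h2
  exact hlow.trans hup

variable (Γ) in
/-- **Rank `≥ [SL₂(ℤ) : Γ]`**: for a level-one basis on `r` generators and a rank input with column
weights, `[SL₂(ℤ) : Γ] ≤ r` (sum of the two parities). [cite: Gannon2014, Thm. 3.4] -/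
theorem IsLevelBasis.index_le' {r : ℕ} {wt : Fin r → ℤ} {F : Fin r → ℍ → ℂ}
    (hb : IsLevelBasis Γ wt F) (R : RankInput' Γ) : Γ.index ≤ r := by
  classical
  have h0 := hb.card_parity_le Γ R 0 (Or.inl rfl)
  have h1 := hb.card_parity_le Γ R 1 (Or.inr rfl)
  have hI : (Finset.univ.filter fun i ↦ R.wtG i % 2 = 0).card +
      (Finset.univ.filter fun i ↦ R.wtG i % 2 = 1).card = Γ.index := by
    have : (Finset.univ.filter fun i ↦ ¬ R.wtG i % 2 = 0) =
        Finset.univ.filter fun i ↦ R.wtG i % 2 = 1 :=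
      Finset.filter_congr fun i _ ↦ by have := Int.emod_two_eq_zero_or_one (R.wtG i); omega
    rw [← this, Finset.card_filter_add_card_filter_not, Finset.card_univ, Fintype.card_fin]
  have hJ : (Finset.univ.filter fun j ↦ wt j % 2 = 0).card +
      (Finset.univ.filter fun j ↦ wt j % 2 = 1).card = r := by
    have : (Finset.univ.filter fun j ↦ ¬ wt j % 2 = 0) =
        Finset.univ.filter fun j ↦ wt j % 2 = 1 :=
      Finset.filter_congr fun j _ ↦ by have := Int.emod_two_eq_zero_or_one (wt j); omega
    rw [← this, Finset.card_filter_add_card_filter_not, Finset.card_univ, Fintype.card_fin]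
  omega

variable (Γ) in
/-- **`rank = [SL₂(ℤ) : Γ]` for every finite-index `Γ ∋ T`**: a rank input with column weights
yields a level-one basis of `M(Γ)` indexed by `Fin [SL₂(ℤ) : Γ]`, of weights `≥ 0`.
[cite: Gannon2014, Thm. 3.4] -/
theorem exists_isLevelBasis_card_eq' (R : RankInput' Γ) :
    ∃ (wt : Fin Γ.index → ℤ) (F : Fin Γ.index → ℍ → ℂ),
      IsLevelBasis Γ wt F ∧ ∀ i, 0 ≤ wt i := by
  obtain ⟨r, wt, F, hb, hle, hwt⟩ := exists_isLevelBasis' Γ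
  have hr : r = Γ.index := le_antisymm hle (IsLevelBasis.index_le' Γ hb R)
  subst hr
  exact ⟨wt, F, hb, hwt⟩

end Rank

/-! ### The determinant consequences from `𝒟 ≢ 0` -/

section Determinant

variable {Γ : Subgroup SL(2, ℤ)} [Γ.FiniteIndex]
variable {wt : Fin (Γ.index) → ℤ} {F : Fin (Γ.index) → ℍ → ℂ}

/-- **`𝒟 ≢ 0`** from a rank input with column weights: at a point where the conjugate matrix of the
`G_i` is invertible, it factors through `Φ(τ)`. [folklore] -/
theorem exists_basisDet_ne_zero' (hb : IsLevelBasis Γ wt F) (R : RankInput' Γ) :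
    ∃ τ, basisDet Γ wt F τ ≠ 0 := by
  classical
  obtain ⟨τ, hτ⟩ := R.det_ne_zero
  refine ⟨τ, fun hD ↦ hτ ?_⟩
  have hspan := fun i : Fin Γ.index ↦ hb.span (R.wtG i) _ (R.mem i)
  choose Q hQ hQsum using hspan
  set e := cosetEquiv Γ
  have hΨ : ∀ a i : Fin Γ.index, cosetSlash Γ (R.wtG i) (R.G i) (e.symm a) τ =
      ∑ j, basisMatrix Γ wt F τ a j * Q i j τ := by
    intro a i
    unfold cosetSlash
    rw [hQsum i, sum_mul_slash_of_levelOne _ (fun j _ ↦ hQ i j), Finset.sum_apply]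
    refine Finset.sum_congr rfl fun j _ ↦ ?_
    rw [Pi.mul_apply, mul_comm]
    rfl
  have hdet : (Matrix.of fun a i : Fin Γ.index ↦ cosetSlash Γ (R.wtG i) (R.G i) (e.symm a) τ).det =
      (basisMatrix Γ wt F τ).det * (Matrix.of fun j i : Fin Γ.index ↦ Q i j τ).det := by
    rw [← Matrix.det_mul]
    congr 1
    ext a i
    simp only [Matrix.of_apply, Matrix.mul_apply, hΨ]
  have : (basisMatrix Γ wt F τ).det = 0 := hD
  rw [hdet, this, zero_mul]

/-- `𝒟¹² = cΔ^K` with `c ≠ 0`, from `𝒟 ≢ 0`. [cite: Gannon2014, Thm. 3.4(b)] -/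
theorem exists_basisDet_pow_eq_ne_zero_of_exists (hb : IsLevelBasis Γ wt F)
    (hD : ∃ τ, basisDet Γ wt F τ ≠ 0) (hK : 0 ≤ totalWeight Γ wt) :
    ∃ c : ℂ, c ≠ 0 ∧ ∀ τ, basisDet Γ wt F τ ^ 12 = c * ModularForm.discriminant τ ^ (totalWeight Γ wt).toNat := by
  obtain ⟨c, hc⟩ := exists_basisDet_pow_eq hb hK
  obtain ⟨τ, hτ⟩ := hD
  refine ⟨c, fun h0 ↦ ?_, hc⟩
  have := hc τ
  rw [h0, zero_mul] at this
  exact pow_ne_zero 12 hτ this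

/-- **`𝒟(τ) ≠ 0` for every `τ ∈ ℍ`**, from `𝒟 ≢ 0`. [cite: Gannon2014, Thm. 3.4(b)] -/
theorem basisDet_ne_zero_of_exists (hb : IsLevelBasis Γ wt F) (hD : ∃ τ, basisDet Γ wt F τ ≠ 0)
    (hK : 0 ≤ totalWeight Γ wt) (τ : ℍ) : basisDet Γ wt F τ ≠ 0 := by
  obtain ⟨c, hc, h⟩ := exists_basisDet_pow_eq_ne_zero_of_exists hb hD hK
  intro h0
  have := h τ
  rw [h0, zero_pow (by norm_num)] at this
  exact mul_ne_zero hc (pow_ne_zero _ (discriminant_ne_zero τ)) this.symm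

/-- **Decay of `𝒟` at `i∞`**: `‖𝒟(τ)‖¹² e^{2πK Im τ} → C > 0`, from `𝒟 ≢ 0`. [folklore] -/
theorem tendsto_norm_basisDet_pow_of_exists (hb : IsLevelBasis Γ wt F)
    (hD : ∃ τ, basisDet Γ wt F τ ≠ 0) (hK : 0 ≤ totalWeight Γ wt) :
    ∃ C : ℝ, 0 < C ∧ Tendsto (fun τ : ℍ ↦ ‖basisDet Γ wt F τ‖ ^ 12 *
      Real.exp (2 * π * ((totalWeight Γ wt).toNat * τ.im))) atImInfty (𝓝 C) := by
  obtain ⟨c, hc, h⟩ := exists_basisDet_pow_eq_ne_zero_of_exists hb hD hK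
  refine ⟨‖c‖, norm_pos_iff.mpr hc, ?_⟩
  have hΔ := tendsto_norm_discriminant_mul_exp.pow (totalWeight Γ wt).toNat
  rw [one_pow] at hΔ
  have := hΔ.const_mul ‖c‖
  rw [mul_one] at this
  refine this.congr fun τ ↦ ?_
  rw [mul_pow, ← Real.exp_nat_mul, ← norm_pow, ← mul_assoc, ← norm_mul, ← h τ, norm_pow]
  congr 2
  ring

/-- The columns of `Φ(τ)` are linearly independent, from `𝒟 ≢ 0`. [folklore] -/
theorem linearIndependent_basisMatrix_col_of_exists (hb : IsLevelBasis Γ wt F)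
    (hD : ∃ τ, basisDet Γ wt F τ ≠ 0) (hK : 0 ≤ totalWeight Γ wt) (τ : ℍ) :
    LinearIndependent ℂ (fun j a ↦ basisMatrix Γ wt F τ a j) := by
  have : IsUnit (basisMatrix Γ wt F τ) :=
    (Matrix.isUnit_iff_isUnit_det _).mpr (isUnit_iff_ne_zero.mpr (basisDet_ne_zero_of_exists hb hD hK τ))
  exact Matrix.linearIndependent_cols_iff_isUnit.mpr this

omit [Γ.FiniteIndex] in
/-- `0 ≤ K` when all weights are `≥ 0`. [folklore] -/
theorem totalWeight_nonneg' (hwt : ∀ j, 0 ≤ wt j) : 0 ≤ totalWeight Γ wt :=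
  Finset.sum_nonneg fun j _ ↦ hwt j

end Determinant

/-! ### The trace method: `∑_j t_j^d = #Fix(σ^d)` and Fourier inversion -/

section Trace

/-- **Trace identity.** If `μ` linearly independent vectors `v_j ∈ ℂ^μ` satisfy
`v_j ∘ σ = t_j v_j` for a permutation `σ` of `Fin μ`, then `∑_j t_j = #{x : σ x = x}`: both sides
are the trace of `f ↦ f ∘ σ`, in the eigenbasis `(v_j)` and in the standard basis. [folklore] -/
theorem sum_eigen_eq_card_fixed {μ : ℕ} (σ : Equiv.Perm (Fin μ)) (v : Fin μ → Fin μ → ℂ)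
    (hli : LinearIndependent ℂ v) (t : Fin μ → ℂ) (ht : ∀ j x, v j (σ x) = t j * v j x) :
    ∑ j, t j = ((Finset.univ.filter fun x ↦ σ x = x).card : ℂ) := by
  classical
  let L : (Fin μ → ℂ) →ₗ[ℂ] (Fin μ → ℂ) := LinearMap.funLeft ℂ ℂ σ
  have hL : ∀ f : Fin μ → ℂ, L f = f ∘ σ := fun f ↦ rfl
  -- the eigenbasis
  have hcard : Fintype.card (Fin μ) = Module.finrank ℂ (Fin μ → ℂ) := by simp
  let b : Module.Basis (Fin μ) ℂ (Fin μ → ℂ) := basisOfLinearIndependentOfCardEqFinrank' v hli hcard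
  have hb : ∀ j, b j = v j := fun j ↦
    congr_fun (coe_basisOfLinearIndependentOfCardEqFinrank' (K := ℂ) v hli hcard) j
  have hLb : ∀ j, L (b j) = t j • b j := fun j ↦ by
    rw [hL, hb]
    funext x
    simp [ht j x]
  have h1 : LinearMap.trace ℂ _ L = ∑ j, t j := by
    rw [LinearMap.trace_eq_matrix_trace ℂ b, Matrix.trace]
    refine Finset.sum_congr rfl fun j _ ↦ ?_
    rw [Matrix.diag_apply, LinearMap.toMatrix_apply, hLb, map_smul, Module.Basis.repr_self]
    simp
  have h2 : LinearMap.trace ℂ _ L = ((Finset.univ.filter fun x ↦ σ x = x).card : ℂ) := by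
    rw [LinearMap.trace_eq_matrix_trace ℂ (Pi.basisFun ℂ (Fin μ)), Matrix.trace]
    rw [Finset.card_eq_sum_ones, Nat.cast_sum, Finset.sum_filter]
    refine Finset.sum_congr rfl fun x _ ↦ ?_
    rw [Matrix.diag_apply, LinearMap.toMatrix_apply, Pi.basisFun_repr, hL, Function.comp_apply,
      Pi.basisFun_apply, Pi.single_apply]
    by_cases hx : σ x = x <;> simp [hx]
  rw [← h1, h2]

/-- **Fourier inversion.** If `∑_j (ζ^{m_j})^d = 0` for `0 < d < q`, `ζ` a primitive `q`-th root of
unity, then `q · #{j : q ∣ m_j - r} = #ι` for every `r`. [folklore] -/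
theorem mul_card_filter_dvd_eq_of_sum_zpow_pow_eq_zero {q : ℕ} (hq : 0 < q) {ζ : ℂ}
    (hζ : IsPrimitiveRoot ζ q) {ι : Type*} [Fintype ι] [DecidableEq ι] (m : ι → ℤ)
    (hsum : ∀ d : ℕ, 0 < d → d < q → ∑ j, (ζ ^ m j) ^ d = 0) (r : ℤ) :
    q * (Finset.univ.filter fun j ↦ (q : ℤ) ∣ m j - r).card = Fintype.card ι := by
  classical
  have hζ0 : ζ ≠ 0 := hζ.ne_zero (by omega)
  -- `∑_{d<q} (ζ^{m_j - r})^d = q` or `0`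
  have hgeom : ∀ j, ∑ d ∈ Finset.range q, (ζ ^ (m j - r)) ^ d =
      if (q : ℤ) ∣ m j - r then (q : ℂ) else 0 := by
    intro j
    split_ifs with hdvd
    · rw [(hζ.zpow_eq_one_iff_dvd _).mpr hdvd]
      simp
    · have hne : ζ ^ (m j - r) ≠ 1 := fun h ↦ hdvd ((hζ.zpow_eq_one_iff_dvd _).mp h)
      rw [geom_sum_eq hne]
      have : (ζ ^ (m j - r)) ^ q = 1 := by
        rw [← zpow_natCast, ← zpow_mul, mul_comm, zpow_mul, zpow_natCast, hζ.pow_eq_one, one_zpow]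
      rw [this, sub_self, zero_div]
  -- sum over `j` of the geometric sums
  have hA : ∑ j, ∑ d ∈ Finset.range q, (ζ ^ (m j - r)) ^ d =
      (q : ℂ) * (Finset.univ.filter fun j ↦ (q : ℤ) ∣ m j - r).card := by
    simp_rw [hgeom]
    rw [Finset.sum_ite, Finset.sum_const_zero, add_zero, Finset.sum_const, nsmul_eq_mul, mul_comm]
  -- swap: `∑_d ζ^{-rd} ∑_j (ζ^{m_j})^d`; only `d = 0` survives
  have hB : ∑ j, ∑ d ∈ Finset.range q, (ζ ^ (m j - r)) ^ d = Fintype.card ι := by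
    rw [Finset.sum_comm]
    have hterm : ∀ d ∈ Finset.range q, ∑ j, (ζ ^ (m j - r)) ^ d =
        (ζ ^ (-r)) ^ d * ∑ j, (ζ ^ m j) ^ d := by
      intro d _
      rw [Finset.mul_sum]
      refine Finset.sum_congr rfl fun j _ ↦ ?_
      rw [← mul_pow, ← zpow_add₀ hζ0]
      congr 1
      ring_nf
    rw [Finset.sum_congr rfl hterm]
    obtain ⟨q', hq'⟩ : ∃ q', q = q' + 1 := ⟨q - 1, by omega⟩
    rw [hq', Finset.sum_range_succ']
    have hrest : ∑ d ∈ Finset.range q', (ζ ^ (-r)) ^ (d + 1) * ∑ j, (ζ ^ m j) ^ (d + 1) = 0 := by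
      refine Finset.sum_eq_zero fun d hd ↦ ?_
      rw [hsum (d + 1) (by omega) (by rw [hq']; exact Nat.succ_lt_succ (Finset.mem_range.mp hd)),
        mul_zero]
    rw [hrest, zero_add]
    simp
  have := hA.symm.trans hB
  exact_mod_cast this

end Trace

/-! ### Weights modulo `q` for a free action with a fixed point of `h` on `ℍ` -/

section Elliptic

variable {Γ : Subgroup SL(2, ℤ)} [Γ.FiniteIndex]
variable {wt : Fin (Γ.index) → ℤ} {F : Fin (Γ.index) → ℍ → ℂ}

/-- Powers of the eigen-relation: `Φ(z₀)_{σ^d a, j} = j(h,z₀)^{-d k_j} Φ(z₀)_{a,j}`. [folklore] -/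
theorem basisMatrix_cosetPermFin_pow (hb : IsLevelBasis Γ wt F) {h : SL(2, ℤ)} {z₀ : ℍ}
    (hz : h • z₀ = z₀) (d : ℕ) (a j : Fin (Γ.index)) :
    basisMatrix Γ wt F z₀ ((cosetPermFin Γ h ^ d) a) j =
      (denom h z₀ ^ (-wt j)) ^ d * basisMatrix Γ wt F z₀ a j := by
  induction d generalizing a with
  | zero => simp
  | succ d ih =>
    rw [pow_succ', Equiv.Perm.mul_apply, basisMatrix_cosetPermFin hb hz, ih, pow_succ']
    ring

/-- Fixed points of `(cosetPermFin h)^d` are the cosets fixed by `h^d`. [folklore] -/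
theorem card_fixed_cosetPermFin_pow (h : SL(2, ℤ)) (d : ℕ) :
    (Finset.univ.filter fun a ↦ (cosetPermFin Γ h ^ d) a = a).card =
      Nat.card {x : SL(2, ℤ) ⧸ Γ // h ^ d • x = x} := by
  classical
  have : cosetPermFin Γ h ^ d = cosetPermFin Γ (h ^ d) := by
    ext a
    rw [cosetPermFin_pow_apply, cosetPermFin_apply, inv_pow]
  rw [this, card_fixed_cosetPermFin]

/-- **Weights modulo `q` for a free action.** Let `h ∈ SL₂(ℤ)` fix `z₀ ∈ ℍ` with `j(h, z₀) = ζ` a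
primitive `q`-th root of unity, and suppose `h^d` fixes no coset of `SL₂(ℤ)/Γ` for `0 < d < q`.
Then for a level-one basis indexed by `Fin [SL₂(ℤ):Γ]` with `𝒟 ≢ 0`:
`q · #{j : k_j ≡ r (mod q)} = [SL₂(ℤ) : Γ]` for every `r` (trace of the coset permutation of `h^d`
in the eigenbasis of columns of `Φ(z₀)`: `∑_j ζ^{-dk_j} = #Fix = 0`, then Fourier inversion).
[cite: Gannon2014, Thm. 3.4(b)] -/
theorem mul_card_weights_dvd_sub_eq (hb : IsLevelBasis Γ wt F) (hD : ∃ τ, basisDet Γ wt F τ ≠ 0)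
    (hwt : ∀ j, 0 ≤ wt j) {h : SL(2, ℤ)} {z₀ : ℍ} (hz : h • z₀ = z₀) {q : ℕ} (hq : 0 < q) {ζ : ℂ}
    (hζ : IsPrimitiveRoot ζ q) (hden : denom h z₀ = ζ)
    (hfree : ∀ d : ℕ, 0 < d → d < q → ∀ x : SL(2, ℤ) ⧸ Γ, h ^ d • x ≠ x) (r : ℤ) :
    q * (Finset.univ.filter fun j ↦ (q : ℤ) ∣ wt j - r).card = Γ.index := by
  classical
  have hK := totalWeight_nonneg' (Γ := Γ) hwt
  have hli := linearIndependent_basisMatrix_col_of_exists hb hD hK z₀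
  -- `∑_j (ζ^{-k_j})^d = #Fix((h⁻¹)^d) = 0` for `0 < d < q`
  have hsum : ∀ d : ℕ, 0 < d → d < q → ∑ j, (ζ ^ (-wt j)) ^ d = 0 := by
    intro d hd hdq
    have h1 := sum_eigen_eq_card_fixed (cosetPermFin Γ h ^ d) (fun j a ↦ basisMatrix Γ wt F z₀ a j) hli
      (fun j ↦ (denom h z₀ ^ (-wt j)) ^ d) (fun j a ↦ basisMatrix_cosetPermFin_pow hb hz d a j)
    rw [card_fixed_cosetPermFin_pow, hden] at h1
    rw [h1]
    have : Nat.card {x : SL(2, ℤ) ⧸ Γ // h ^ d • x = x} = 0 := by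
      rw [Nat.card_eq_zero]
      exact Or.inl ⟨fun x ↦ hfree d hd hdq x.1 x.2⟩
    rw [this, Nat.cast_zero]
  have key := mul_card_filter_dvd_eq_of_sum_zpow_pow_eq_zero hq hζ (fun j ↦ -wt j) hsum (-r)
  rw [Fintype.card_fin] at key
  have hF : (Finset.univ.filter fun j ↦ (q : ℤ) ∣ wt j - r) =
      Finset.univ.filter fun j ↦ (q : ℤ) ∣ -wt j - -r :=
    Finset.filter_congr fun j _ ↦ by rw [show -wt j - -r = -(wt j - r) by ring, dvd_neg]
  rw [hF]
  exact key

/-! #### `S`: order `4`, free whenever `-1 ∉ Γ` -/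

omit [Γ.FiniteIndex] in
/-- `g • x = x` on `SL₂(ℤ)/Γ` for `x = aΓ` iff `a⁻¹ g a ∈ Γ`. [folklore] -/
theorem smul_mk_eq_iff (g a : SL(2, ℤ)) :
    g • (a : SL(2, ℤ) ⧸ Γ) = a ↔ a⁻¹ * g * a ∈ Γ := by
  rw [MulAction.Quotient.smul_mk, smul_eq_mul, QuotientGroup.eq,
    show (g * a)⁻¹ * a = (a⁻¹ * g * a)⁻¹ by group, inv_mem_iff]

omit [Γ.FiniteIndex] in
/-- If `g • x = x` for some coset `x` and `g² = -1`, then `-1 ∈ Γ`. [folklore] -/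
theorem neg_one_mem_of_smul_eq_of_sq {g : SL(2, ℤ)} (hg : g ^ 2 = -1) {x : SL(2, ℤ) ⧸ Γ}
    (hx : g • x = x) : (-1 : SL(2, ℤ)) ∈ Γ := by
  induction x using QuotientGroup.induction_on with
  | H a =>
    rw [smul_mk_eq_iff] at hx
    have := Γ.mul_mem hx hx
    rwa [show a⁻¹ * g * a * (a⁻¹ * g * a) = a⁻¹ * (g * g) * a by group, ← sq, hg,
      show a⁻¹ * (-1 : SL(2, ℤ)) * a = -1 by simp] at this

omit [Γ.FiniteIndex] in
/-- **`S` acts freely on `SL₂(ℤ)/Γ` when `-1 ∉ Γ`**: `S^d`, `d = 1, 2, 3`, fixes no coset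
(`S² = -1`, and `S`, `S³ = -S` square to `-1`). [folklore] -/
theorem S_pow_smul_ne_of_neg_one_not_mem (hneg : (-1 : SL(2, ℤ)) ∉ Γ) (d : ℕ) (hd : 0 < d)
    (hd4 : d < 4) (x : SL(2, ℤ) ⧸ Γ) : ModularGroup.S ^ d • x ≠ x := by
  intro hx
  have hS2 : ModularGroup.S ^ 2 = (-1 : SL(2, ℤ)) := S_sq_eq
  interval_cases d
  · rw [pow_one] at hx
    exact hneg (neg_one_mem_of_smul_eq_of_sq hS2 hx)
  · rw [hS2] at hx
    induction x using QuotientGroup.induction_on with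
    | H a =>
      rw [smul_mk_eq_iff] at hx
      exact hneg (by simpa using hx)
  · have h3 : ModularGroup.S ^ 3 = -ModularGroup.S := by rw [pow_succ, hS2]; simp
    rw [h3] at hx
    exact hneg (neg_one_mem_of_smul_eq_of_sq (g := -ModularGroup.S) (by rw [neg_sq, hS2]) hx)

/-- `i` is a primitive fourth root of unity. [folklore] -/
theorem isPrimitiveRoot_I_four : IsPrimitiveRoot Complex.I 4 := by
  have h := Complex.isPrimitiveRoot_exp 4 (by norm_num)
  have : Complex.exp (2 * π * Complex.I / (4 : ℕ)) = Complex.I := by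
    rw [show (2 * π * Complex.I / (4 : ℕ) : ℂ) = (π / 2 : ℂ) * Complex.I by push_cast; ring]
    rw [Complex.exp_mul_I]
    rw [show (π / 2 : ℂ) = ((π / 2 : ℝ) : ℂ) by push_cast; ring, ← Complex.ofReal_cos,
      ← Complex.ofReal_sin, Real.cos_pi_div_two, Real.sin_pi_div_two]
    simp
  rwa [this] at h

/-- **Weights modulo `4` for `Γ ∌ -1`**: `4 · #{j : k_j ≡ r (4)} = [SL₂(ℤ) : Γ]` for every `r`
(in particular `[SL₂(ℤ):Γ]/2` generators of each parity). [cite: Gannon2014, Thm. 3.4(b)] -/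
theorem four_mul_card_weights_eq (hb : IsLevelBasis Γ wt F) (hD : ∃ τ, basisDet Γ wt F τ ≠ 0)
    (hwt : ∀ j, 0 ≤ wt j) (hneg : (-1 : SL(2, ℤ)) ∉ Γ) (r : ℤ) :
    4 * (Finset.univ.filter fun j ↦ (4 : ℤ) ∣ wt j - r).card = Γ.index := by
  have hden : denom ModularGroup.S UpperHalfPlane.I = Complex.I := by
    rw [ModularGroup.denom_S]; rfl
  exact mul_card_weights_dvd_sub_eq hb hD hwt S_smul_I (by norm_num) isPrimitiveRoot_I_four hden
    (fun d hd hd4 x ↦ S_pow_smul_ne_of_neg_one_not_mem hneg d hd hd4 x) r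

/-! #### `ST`: order `6` -/

/-- `ρ + 1 = e^{iπ/3}` is a primitive sixth root of unity (`(ρ+1)² = ρ`, `ρ³ = 1`). [folklore] -/
theorem isPrimitiveRoot_rho_add_one_six : IsPrimitiveRoot ((UpperHalfPlane.ρ : ℂ) + 1) 6 := by
  set ρ' : ℂ := (UpperHalfPlane.ρ : ℂ) with hρ'
  have hsq : (ρ' + 1) ^ 2 = ρ' := by linear_combination UpperHalfPlane.ρ_sq
  have h3 : ρ' ^ 3 = 1 := rho_pow_three
  obtain ⟨h1, h2⟩ := rho_ne_one
  have hρ0 : ρ' ≠ 0 := fun h ↦ by rw [h] at h3; norm_num at h3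
  have hcube : (ρ' + 1) ^ 3 = -1 := by
    rw [pow_succ, hsq]; linear_combination UpperHalfPlane.ρ_sq
  refine IsPrimitiveRoot.mk_of_lt _ (by norm_num) ?_ fun l hl hl6 ↦ ?_
  · rw [show (6 : ℕ) = 2 * 3 by norm_num, pow_mul, hsq, h3]
  · interval_cases l
    · rw [pow_one]
      intro h
      exact hρ0 (by linear_combination h)
    · rw [hsq]; exact h1
    · rw [hcube]; norm_num
    · rw [show (4 : ℕ) = 2 * 2 by norm_num, pow_mul, hsq]; exact h2
    · rw [show (5 : ℕ) = 2 + 3 by norm_num, pow_add, hsq, hcube]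
      intro h
      have hm1 : ρ' = -1 := by linear_combination -h
      rw [hm1] at h3
      norm_num at h3

/-- **Weights modulo `6` for a free `ST`-action**: if `(ST)^d`, `0 < d < 6`, fixes no coset of
`SL₂(ℤ)/Γ`, then `6 · #{j : k_j ≡ r (6)} = [SL₂(ℤ) : Γ]` for every `r`. [cite: Gannon2014, Thm. 3.4(b)] -/
theorem six_mul_card_weights_eq (hb : IsLevelBasis Γ wt F) (hD : ∃ τ, basisDet Γ wt F τ ≠ 0)
    (hwt : ∀ j, 0 ≤ wt j)
    (hfree : ∀ d : ℕ, 0 < d → d < 6 → ∀ x : SL(2, ℤ) ⧸ Γ,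
      (ModularGroup.S * ModularGroup.T) ^ d • x ≠ x) (r : ℤ) :
    6 * (Finset.univ.filter fun j ↦ (6 : ℤ) ∣ wt j - r).card = Γ.index :=
  mul_card_weights_dvd_sub_eq hb hD hwt ST_smul_rho (by norm_num) isPrimitiveRoot_rho_add_one_six
    denom_ST_rho hfree r

end Elliptic

end Level

end Literature.NumberTheory.EllipticCurves.ModularForms
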